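import Mathlib.Analysis.InnerProductSpace.Adjoint

/-!
# `Balaban1983to89.B9Eq324ConjugatedFormDifference` — T. Bałaban, *Propagators for lattice gauge theories in a background field*, Commun. Math.
# Phys. **99** (1985) 389–434 [Balaban1985BackgroundPropagators] (3.23)–(3.25) p. 394 with (3.49) p. 399: **THE COMBES–THOMAS CONJUGATE OF THE
# SITE OPERATOR `H = Δ′_a(U) = D†D + a′Q̃′†Q̃′` — `H₊ − H = D†B₊ + B₋†D + B₋†B₊ + a′(Q̃′†E₊ + E₋†Q̃′ + E₋†E₊)`, `B± = D± − D`, `E± = Q̃′± − Q̃′`,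
# AND THE FOUR §4 LETTERS OF `B9Eq349ConjugatedProjection` (`‖Df‖² ≤ re⟪f,Hf⟫`, `H₊A₊ = Q̃′†₊`, `‖Q̃′†₊‖ ≤ m`, `re⟪y,(H − H₊)y⟫ ≤ 2β‖Dy‖‖y‖ + c‖y‖²`)
# AS THEOREMS OF THAT STRUCTURE** modulo the bond∕block conjugation letters `β±`, `ε±`, `M` — route R2′ STEP B8′ S-P5(b) of the pub-balaban NE9 chain

statement-level skeleton of published theorems with citation tags; proofs where landed; nothing here is a claim about the Yang–Mills mass gap

CITATION HEADER (lean-in-tree rule).  Audit cell `pub-balaban`, sub-cell `t4`, BINDER row NE9; filed by NE9 formalisation-swarm leaf prover 06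
(`b2b-balaban-t4-ne9-formalise-leaf-06`, gen 65) as the PORT of the NE9 crux-ideation seat's abstract kernel
`t4/ideate/NE9/lens1-NE9ConjugatedFormDifference.lean` (t4-ne9-idea-1 gen 90, sha16 7cc375d244cd3aaa; scratch, never proposed — CREDIT: every statement
and proof idea below is that kernel's, re-dressed def-free for `𝕜`-LINEAR maps on finite-dimensional spaces with `†` = Mathlib's `LinearMap.adjoint`
(the kernel's `ContinuousLinearMap.adjoint` ↦ `LinearMap.adjoint` verbatim, as its own header prescribes for the chain's `→ₗ[ℂ]` objects); offered to
this porter journal l.47658 «KERNEL 4 OFFERED to the same porter as kernel 3's §4 companion») for `t4/ROUTES-NE9.md` v13.27 R2′ STEP B8′ S-P5(b).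
Source READ in the held text (`paper:balaban1985-cmp99-background-propagators`, journal page = PDF page + 388): p. 394 (3.23)–(3.25), p. 399 (3.49).

THE PRINT (verbatim).  p. 394: *«Δ′_a(U) = Δ^η_U + Q′*(U)aQ′(U) (3.24) … Rf = (I − G′Q′*(Q′G′²Q′*)⁻¹Q′G′)f, where G′ = G′(U) = (Δ′_a)⁻¹ (3.25)»*;
p. 399: *«For the operator P = I − R we obtain, using again Lemma 2.1, [|P(x, x′)|, |(DP)_μ(x, x′)|, …] ≤ O(1)[…]e^{−δ₀d(y,y′)} … (3.49)»*.  Print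
proves (3.49) by generalized random-walk expansions; NOTHING of that is asserted here.

WHY (route R2′ STEP B8′ S-P5(b), companion of `B9Eq349ConjugatedProjection` §4).  The oblique-projection bound for the conjugate `S P S⁻¹` absorbs
the derivative on the conjugated range through five letters; four of them are consequences of the STRUCTURE of print's site operator `H = Δ′_a(U) =
D†D + a′Q̃′†Q̃′` ((3.24)), of `Δ′_aG′ = 1` ((3.25): `H(Ag) = Q̃′†g` for `A = G′Q̃′†`), of the one-sided identities `S⁻¹S = 1`, `S_B⁻¹S_B = 1`, `S_G⁻¹S_G = 1`
of the multiplication operators `S = e^{κχ}` on sites ∕ bonds ∕ blocks, and of the conjugation letters `‖D± − D‖ ≤ β±`, `‖Q̃′± − Q̃′‖ ≤ ε±`, `‖Q̃′‖ ≤ M`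
(`D₊ = S_BDS⁻¹`, `D₋ = (S_B⁻¹)†DS†`, `Q̃′₊ = S_GQ̃′S⁻¹`, `Q̃′₋ = (S_G⁻¹)†Q̃′S†`; their lattice instances are `B9Eq3101ConjugationLetters(Chain)` when landed).
The fifth (`‖h‖ ≤ C_g‖A₊h‖`) is `B9Eq349ConjugatedProjection.sqrt_sub_mul_norm_le` + the window, or a `κ₁`-free Schur bound — not here.

WHAT IS PROVED (sorry-free; proof lane — no `def`, no `Prop` placeholder; [folklore] Hilbert-space algebra over `RCLike 𝕜`; nothing of [B9] asserted).
* §0 Gram-term algebra: `inner_sub_inner_eq`, `norm_inner_sub_inner_le`, **`norm_gram_pert_le`** (`‖⟪T₋x, T₊y⟫ − ⟪Tx, Ty⟫‖ ≤ β₊‖Tx‖‖y‖ + β₋‖x‖‖Ty‖ +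
  β₋β₊‖x‖‖y‖`), `norm_le_of_inner_eq_inner` (a bound passes through an adjoint pairing).
* §1 THE STRUCTURE (letters `hH : H f = D†(Df) + a′·Q̃′†(Q̃′f)`, `hHp : H₊ f = S(H(S⁻¹f))`, `hSB`, `hSG`, `hDp`, `hDm`, `hQp`, `hQm`): `inner_H`
  (`⟪x, Hy⟫ = ⟪Dx, Dy⟫ + a′⟪Q̃′x, Q̃′y⟫` — the sesquilinear (3.24), the tree's one-step `B9Eq364GreenLipschitzForm.inner_laplacePrimeA_eq`), `re_inner_H_self`
  (the tree's `B9Thm311DeltaPrimeA.re_inner_laplacePrimeA`), **`inner_Hp`** (`⟪x, H₊y⟫ = ⟪D₋x, D₊y⟫ + a′⟪Q̃′₋x, Q̃′₊y⟫`), **`inner_Hp_sub_H`**, **`Hp_sub_H_eq`**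
  (the operator identity for `H₊ − H`).
* §2 THE DISCHARGES in `B9Eq349ConjugatedProjection` §4's SYNTACTIC shapes (junction by `exact`): **`hHD_of_structure`** (`‖Df‖² ≤ re⟪f,Hf⟫`, `a′ ≥ 0`),
  **`hHAp_of_structure`** (`H₊(A₊h) = Q̃′†₊h`), `inner_Qdp_eq`, `norm_Qm_le`, **`hm_of_structure`** (`W = S_G⁻¹ ⇒ ‖Q̃′†₊h‖ ≤ (M + ε₋)‖h‖`),
  **`re_inner_H_sub_Hp_le`** ∕ `re_inner_Hp_sub_H_le` (`≤ (β₊ + β₋)‖Dy‖‖y‖ + (β₊β₋ + a′((ε₊ + ε₋)M + ε₊ε₋))‖y‖²`), **`hHH_of_structure`** (symmetric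
  letters: `≤ 2β‖Dy‖‖y‖ + (β² + a′(2Mε + ε²))‖y‖²` — LITERALLY the `hHH` binder of `B9Eq349ConjugatedProjection.norm_D_le_on_range` ∕ `norm_conjDP_le_two`).
* §3 non-vacuity `example` (zero maps on `𝕜`).
HONEST SCOPE.  Symbolic; no lattice instance of `S`, `D±`, `Q̃′±`, `β±`, `ε±` (S-P5(b) porter's ∕ (I4)); no decay rate; no number; ONE companion device of ONE
sub-step of a route step, NOT NE9 (cell pub-balaban: NE9 NOT PRINTED ∕ NOT PROVED; «NE9 ⇐ the named binders»; spine PROVED 0∕9; rung (B)+1 on a finite T⁴ —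
NOT infinite volume, NOT mass gap, NOT Clay; HONEST DEPENDENCY: continuum YM on T⁴ ⇐ BetaPertH ∧ nine spine estimates (0/9 proved); BetaPertH ⇐ (D1) ∧ (D4) ∧
CAP+tail; G-an2-4 gates asym, D1 and NE2/3/4).  NEW file, Mathlib-only imports; nothing modified.  Net new unproved facts: 0.
-/

namespace Literature.MathematicalPhysics.QuantumFieldTheory.Balaban1983to89.B9Eq324ConjugatedFormDifference

open scoped InnerProductSpace

variable {𝕜 : Type*} [RCLike 𝕜] {E : Type*} [NormedAddCommGroup E] [InnerProductSpace 𝕜 E] [FiniteDimensional 𝕜 E]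
  {G : Type*} [NormedAddCommGroup G] [InnerProductSpace 𝕜 G] [FiniteDimensional 𝕜 G]
  {B : Type*} [NormedAddCommGroup B] [InnerProductSpace 𝕜 B] [FiniteDimensional 𝕜 B]

/-! ## §0 Gram-term algebra -/

section Gram

variable {F : Type*} [NormedAddCommGroup F] [InnerProductSpace 𝕜 F]

/-- `⟪u′, v′⟫ − ⟪u, v⟫ = ⟪u, v′ − v⟫ + ⟪u′ − u, v⟫ + ⟪u′ − u, v′ − v⟫`. [folklore] [cite: Balaban1985BackgroundPropagators, (3.24) p.394] -/
theorem inner_sub_inner_eq (u u' v v' : F) : ⟪u', v'⟫_𝕜 - ⟪u, v⟫_𝕜 = ⟪u, v' - v⟫_𝕜 + ⟪u' - u, v⟫_𝕜 + ⟪u' - u, v' - v⟫_𝕜 := by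
  simp only [inner_sub_left, inner_sub_right]; ring

/-- `‖⟪u′, v′⟫ − ⟪u, v⟫‖ ≤ ‖u‖‖v′ − v‖ + ‖u′ − u‖‖v‖ + ‖u′ − u‖‖v′ − v‖`. [folklore] [cite: Balaban1985BackgroundPropagators, (3.24) p.394] -/
theorem norm_inner_sub_inner_le (u u' v v' : F) :
    ‖⟪u', v'⟫_𝕜 - ⟪u, v⟫_𝕜‖ ≤ ‖u‖ * ‖v' - v‖ + ‖u' - u‖ * ‖v‖ + ‖u' - u‖ * ‖v' - v‖ := by
  rw [inner_sub_inner_eq]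
  exact (norm_add₃_le).trans (add_le_add (add_le_add (norm_inner_le_norm _ _) (norm_inner_le_norm _ _)) (norm_inner_le_norm _ _))

/-- **TWO-SIDED PERTURBATION OF A GRAM TERM**: `‖T₊y − Ty‖ ≤ β₊‖y‖`, `‖T₋x − Tx‖ ≤ β₋‖x‖` ⇒
`‖⟪T₋x, T₊y⟫ − ⟪Tx, Ty⟫‖ ≤ β₊‖Tx‖‖y‖ + β₋‖x‖‖Ty‖ + β₋β₊‖x‖‖y‖`. [folklore] [cite: Balaban1985BackgroundPropagators, (3.24) p.394, (3.49) p.399] -/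
theorem norm_gram_pert_le {X : Type*} [NormedAddCommGroup X] {T Tp Tm : X → F} {βp βm : ℝ} (hβm0 : 0 ≤ βm)
    (hp : ∀ y, ‖Tp y - T y‖ ≤ βp * ‖y‖) (hm : ∀ x, ‖Tm x - T x‖ ≤ βm * ‖x‖) (x y : X) :
    ‖⟪Tm x, Tp y⟫_𝕜 - ⟪T x, T y⟫_𝕜‖ ≤ βp * ‖T x‖ * ‖y‖ + βm * ‖x‖ * ‖T y‖ + βm * βp * ‖x‖ * ‖y‖ := by
  have h := norm_inner_sub_inner_le (𝕜 := 𝕜) (T x) (Tm x) (T y) (Tp y)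
  have h1 : ‖T x‖ * ‖Tp y - T y‖ ≤ ‖T x‖ * (βp * ‖y‖) := mul_le_mul_of_nonneg_left (hp y) (norm_nonneg _)
  have h2 : ‖Tm x - T x‖ * ‖T y‖ ≤ βm * ‖x‖ * ‖T y‖ := mul_le_mul_of_nonneg_right (hm x) (norm_nonneg _)
  have h3 : ‖Tm x - T x‖ * ‖Tp y - T y‖ ≤ βm * ‖x‖ * (βp * ‖y‖) := mul_le_mul (hm x) (hp y) (norm_nonneg _) (mul_nonneg hβm0 (norm_nonneg _))
  linarith [h, h1, h2, h3]

/-- A bound passes through an adjoint pairing: `⟪Kh, z⟫ = ⟪h, Lz⟫` for all `h, z` and `‖Lz‖ ≤ m‖z‖` ⇒ `‖Kh‖ ≤ m‖h‖`. [folklore] [cite: Balaban1985BackgroundPropagators, (3.19) p.393, (3.24) p.394] -/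
theorem norm_le_of_inner_eq_inner {X : Type*} [NormedAddCommGroup X] [InnerProductSpace 𝕜 X] {K : X → F} {L : F → X} {m : ℝ} (hm0 : 0 ≤ m)
    (hKL : ∀ h z, ⟪K h, z⟫_𝕜 = ⟪h, L z⟫_𝕜) (hL : ∀ z, ‖L z‖ ≤ m * ‖z‖) (h : X) : ‖K h‖ ≤ m * ‖h‖ := by
  have h1 : ‖K h‖ ^ 2 ≤ ‖h‖ * (m * ‖K h‖) := by
    calc ‖K h‖ ^ 2 = RCLike.re ⟪K h, K h⟫_𝕜 := (inner_self_eq_norm_sq (𝕜 := 𝕜) _).symm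
      _ = RCLike.re ⟪h, L (K h)⟫_𝕜 := by rw [hKL]
      _ ≤ ‖h‖ * ‖L (K h)‖ := re_inner_le_norm _ _
      _ ≤ ‖h‖ * (m * ‖K h‖) := mul_le_mul_of_nonneg_left (hL _) (norm_nonneg _)
  by_cases hK : ‖K h‖ = 0
  · rw [hK]; exact mul_nonneg hm0 (norm_nonneg _)
  · have hKpos : 0 < ‖K h‖ := lt_of_le_of_ne (norm_nonneg _) (Ne.symm hK)
    have h2 : ‖K h‖ * ‖K h‖ ≤ m * ‖h‖ * ‖K h‖ := by nlinarith [h1]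
    exact le_of_mul_le_mul_right h2 hKpos

end Gram

/-! ## §1 The structure `H = D†D + a′Q̃′†Q̃′`, its conjugate `H₊ = S H S⁻¹`, and the identity for `H₊ − H` -/

section Structure

variable {D Dp Dm : E →ₗ[𝕜] B} {Q Qp Qm : E →ₗ[𝕜] G} {H Hp S Sinv : E →ₗ[𝕜] E} {SB SBinv : B →ₗ[𝕜] B} {SG SGinv : G →ₗ[𝕜] G} {a' : ℝ}

/-- THE FORM OF `H = D†D + a′Q̃′†Q̃′`: `⟪x, Hy⟫ = ⟪Dx, Dy⟫ + a′⟪Q̃′x, Q̃′y⟫` (the sesquilinear (3.24); on the chain: `B9Eq364GreenLipschitzForm.inner_laplacePrimeA_eq`).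
[cite: Balaban1985BackgroundPropagators, (3.23)–(3.24) p.394] -/
theorem inner_H (hH : ∀ f, H f = (LinearMap.adjoint D) (D f) + ((a' : ℝ) : 𝕜) • (LinearMap.adjoint Q) (Q f)) (x y : E) :
    ⟪x, H y⟫_𝕜 = ⟪D x, D y⟫_𝕜 + ((a' : ℝ) : 𝕜) * ⟪Q x, Q y⟫_𝕜 := by
  rw [hH, inner_add_right, inner_smul_right, LinearMap.adjoint_inner_right, LinearMap.adjoint_inner_right]

/-- `re⟪f, Hf⟫ = ‖Df‖² + a′‖Q̃′f‖²` (the quadratic (3.24); on the chain: `B9Thm311DeltaPrimeA.re_inner_laplacePrimeA`). [cite: Balaban1985BackgroundPropagators, (3.24) p.394] -/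
theorem re_inner_H_self (hH : ∀ f, H f = (LinearMap.adjoint D) (D f) + ((a' : ℝ) : 𝕜) • (LinearMap.adjoint Q) (Q f)) (f : E) :
    RCLike.re ⟪f, H f⟫_𝕜 = ‖D f‖ ^ 2 + a' * ‖Q f‖ ^ 2 := by
  rw [inner_H hH, map_add, RCLike.re_ofReal_mul, inner_self_eq_norm_sq, inner_self_eq_norm_sq]

/-- **THE FORM OF THE CONJUGATE `H₊ = S H S⁻¹`**: `⟪x, H₊y⟫ = ⟪D₋x, D₊y⟫ + a′⟪Q̃′₋x, Q̃′₊y⟫` with `D₊ = S_BDS⁻¹`, `D₋ = (S_B⁻¹)†DS†`, `Q̃′₊ = S_GQ̃′S⁻¹`,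
`Q̃′₋ = (S_G⁻¹)†Q̃′S†` (one-sided `S_B⁻¹S_B = 1`, `S_G⁻¹S_G = 1`). [folklore] [cite: Balaban1985BackgroundPropagators, (3.24) p.394, (3.49) p.399] -/
theorem inner_Hp (hH : ∀ f, H f = (LinearMap.adjoint D) (D f) + ((a' : ℝ) : 𝕜) • (LinearMap.adjoint Q) (Q f))
    (hHp : ∀ f, Hp f = S (H (Sinv f))) (hSB : ∀ u, SBinv (SB u) = u) (hSG : ∀ v, SGinv (SG v) = v)
    (hDp : ∀ f, Dp f = SB (D (Sinv f))) (hDm : ∀ f, Dm f = (LinearMap.adjoint SBinv) (D ((LinearMap.adjoint S) f)))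
    (hQp : ∀ f, Qp f = SG (Q (Sinv f))) (hQm : ∀ f, Qm f = (LinearMap.adjoint SGinv) (Q ((LinearMap.adjoint S) f))) (x y : E) :
    ⟪x, Hp y⟫_𝕜 = ⟪Dm x, Dp y⟫_𝕜 + ((a' : ℝ) : 𝕜) * ⟪Qm x, Qp y⟫_𝕜 := by
  rw [hHp, ← LinearMap.adjoint_inner_left S, inner_H hH, hDm, hDp, hQm, hQp, LinearMap.adjoint_inner_left SBinv,
    LinearMap.adjoint_inner_left SGinv, hSB, hSG]

/-- **THE IDENTITY FOR `H₊ − H`, SESQUILINEAR FORM**: `⟪x, (H₊ − H)y⟫ = ⟪Dx, B₊y⟫ + ⟪B₋x, Dy⟫ + ⟪B₋x, B₊y⟫ + a′(⟪Q̃′x, E₊y⟫ + ⟪E₋x, Q̃′y⟫ + ⟪E₋x, E₊y⟫)`,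
`B± = D± − D`, `E± = Q̃′± − Q̃′`. [folklore] [cite: Balaban1985BackgroundPropagators, (3.24) p.394, (3.49) p.399] -/
theorem inner_Hp_sub_H (hH : ∀ f, H f = (LinearMap.adjoint D) (D f) + ((a' : ℝ) : 𝕜) • (LinearMap.adjoint Q) (Q f))
    (hHp : ∀ f, Hp f = S (H (Sinv f))) (hSB : ∀ u, SBinv (SB u) = u) (hSG : ∀ v, SGinv (SG v) = v)
    (hDp : ∀ f, Dp f = SB (D (Sinv f))) (hDm : ∀ f, Dm f = (LinearMap.adjoint SBinv) (D ((LinearMap.adjoint S) f)))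
    (hQp : ∀ f, Qp f = SG (Q (Sinv f))) (hQm : ∀ f, Qm f = (LinearMap.adjoint SGinv) (Q ((LinearMap.adjoint S) f))) (x y : E) :
    ⟪x, Hp y - H y⟫_𝕜 = (⟪D x, (Dp - D) y⟫_𝕜 + ⟪(Dm - D) x, D y⟫_𝕜 + ⟪(Dm - D) x, (Dp - D) y⟫_𝕜) +
      ((a' : ℝ) : 𝕜) * (⟪Q x, (Qp - Q) y⟫_𝕜 + ⟪(Qm - Q) x, Q y⟫_𝕜 + ⟪(Qm - Q) x, (Qp - Q) y⟫_𝕜) := by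
  rw [inner_sub_right, inner_Hp hH hHp hSB hSG hDp hDm hQp hQm, inner_H hH]
  simp only [LinearMap.sub_apply, inner_sub_left, inner_sub_right]
  ring

/-- **THE IDENTITY FOR `H₊ − H`, OPERATOR FORM**: `H₊ − H = D†B₊ + B₋†D + B₋†B₊ + a′(Q̃′†E₊ + E₋†Q̃′ + E₋†E₊)`.
[folklore] [cite: Balaban1985BackgroundPropagators, (3.24) p.394, (3.49) p.399] -/
theorem Hp_sub_H_eq (hH : ∀ f, H f = (LinearMap.adjoint D) (D f) + ((a' : ℝ) : 𝕜) • (LinearMap.adjoint Q) (Q f))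
    (hHp : ∀ f, Hp f = S (H (Sinv f))) (hSB : ∀ u, SBinv (SB u) = u) (hSG : ∀ v, SGinv (SG v) = v)
    (hDp : ∀ f, Dp f = SB (D (Sinv f))) (hDm : ∀ f, Dm f = (LinearMap.adjoint SBinv) (D ((LinearMap.adjoint S) f)))
    (hQp : ∀ f, Qp f = SG (Q (Sinv f))) (hQm : ∀ f, Qm f = (LinearMap.adjoint SGinv) (Q ((LinearMap.adjoint S) f))) :
    Hp - H = (LinearMap.adjoint D ∘ₗ (Dp - D) + LinearMap.adjoint (Dm - D) ∘ₗ D + LinearMap.adjoint (Dm - D) ∘ₗ (Dp - D)) +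
      ((a' : ℝ) : 𝕜) • (LinearMap.adjoint Q ∘ₗ (Qp - Q) + LinearMap.adjoint (Qm - Q) ∘ₗ Q + LinearMap.adjoint (Qm - Q) ∘ₗ (Qp - Q)) := by
  ext y
  refine ext_inner_left 𝕜 fun x => ?_
  rw [LinearMap.sub_apply, inner_Hp_sub_H hH hHp hSB hSG hDp hDm hQp hQm]
  simp only [LinearMap.add_apply, LinearMap.smul_apply, LinearMap.comp_apply, inner_add_right, inner_smul_right, LinearMap.adjoint_inner_right]

/-! ## §2 The discharges, in `B9Eq349ConjugatedProjection` §4's syntactic shapes -/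

/-- **`hHD` DISCHARGED**: `a′ ≥ 0` ⇒ `‖Df‖² ≤ re⟪f, Hf⟫` (on the chain: `B9Eq364GreenLipschitzForm.norm_covDerivL2K_le_sqrt_re_inner`, squared). [cite: Balaban1985BackgroundPropagators, (3.24) p.394] -/
theorem hHD_of_structure (hH : ∀ f, H f = (LinearMap.adjoint D) (D f) + ((a' : ℝ) : 𝕜) • (LinearMap.adjoint Q) (Q f)) (ha : 0 ≤ a') (f : E) :
    ‖D f‖ ^ 2 ≤ RCLike.re ⟪f, H f⟫_𝕜 := by
  rw [re_inner_H_self hH]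
  nlinarith [sq_nonneg ‖Q f‖]

omit [FiniteDimensional 𝕜 B] in
/-- **`hHA₊` DISCHARGED**: `H(Ag) = Q̃′†g` (`Δ′_aG′ = 1`, `A = G′Q̃′†`; on the chain `B9Thm311DeltaPrimeA.laplacePrimeA_GpOfU`), `S⁻¹S = 1`, `A₊ = SAW`,
`Q̃′†₊ = SQ̃′†W` ⇒ `H₊(A₊h) = Q̃′†₊h`. [folklore] [cite: Balaban1985BackgroundPropagators, (3.25) p.394, (3.49) p.399] -/
theorem hHAp_of_structure {A Ap Qdp : G →ₗ[𝕜] E} {W : G → G} (hHp : ∀ f, Hp f = S (H (Sinv f))) (hSinvS : ∀ x, Sinv (S x) = x)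
    (hHA : ∀ g, H (A g) = (LinearMap.adjoint Q) g) (hAp : ∀ h, Ap h = S (A (W h))) (hQdp : ∀ h, Qdp h = S ((LinearMap.adjoint Q) (W h))) (h : G) :
    Hp (Ap h) = Qdp h := by
  rw [hHp, hAp, hSinvS, hHA, hQdp]

omit [FiniteDimensional 𝕜 B] in
/-- The adjoint pairing behind `hm`: with `W = S_G⁻¹`, `⟪Q̃′†₊h, z⟫ = ⟪h, Q̃′₋z⟫` (`Q̃′†₊ = Q̃′₋†`). [folklore] [cite: Balaban1985BackgroundPropagators, (3.19) p.393, (3.24) p.394] -/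
theorem inner_Qdp_eq {Qdp : G →ₗ[𝕜] E} (hQdp : ∀ h, Qdp h = S ((LinearMap.adjoint Q) (SGinv h)))
    (hQm : ∀ f, Qm f = (LinearMap.adjoint SGinv) (Q ((LinearMap.adjoint S) f))) (h : G) (z : E) : ⟪Qdp h, z⟫_𝕜 = ⟪h, Qm z⟫_𝕜 := by
  rw [hQdp, hQm, ← LinearMap.adjoint_inner_right S, LinearMap.adjoint_inner_left Q, LinearMap.adjoint_inner_right SGinv]

omit [FiniteDimensional 𝕜 E] [FiniteDimensional 𝕜 G] [FiniteDimensional 𝕜 B] in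
/-- `‖Q̃′₋z‖ ≤ (M + ε₋)‖z‖` from the block letters. [folklore] [cite: Balaban1985BackgroundPropagators, (3.19) p.393] -/
theorem norm_Qm_le {M εm : ℝ} (hM : ∀ y, ‖Q y‖ ≤ M * ‖y‖) (hEm : ∀ y, ‖Qm y - Q y‖ ≤ εm * ‖y‖) (z : E) : ‖Qm z‖ ≤ (M + εm) * ‖z‖ := by
  calc ‖Qm z‖ = ‖(Qm z - Q z) + Q z‖ := by rw [sub_add_cancel]
    _ ≤ ‖Qm z - Q z‖ + ‖Q z‖ := norm_add_le _ _
    _ ≤ εm * ‖z‖ + M * ‖z‖ := add_le_add (hEm z) (hM z)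
    _ = (M + εm) * ‖z‖ := by ring

omit [FiniteDimensional 𝕜 B] in
/-- **`hm` DISCHARGED**: `W = S_G⁻¹`, `‖Q̃′y‖ ≤ M‖y‖`, `‖Q̃′₋y − Q̃′y‖ ≤ ε₋‖y‖` ⇒ `‖Q̃′†₊h‖ ≤ (M + ε₋)‖h‖`. [folklore] [cite: Balaban1985BackgroundPropagators, (3.19) p.393, (3.49) p.399] -/
theorem hm_of_structure {Qdp : G →ₗ[𝕜] E} {M εm : ℝ} (hM0 : 0 ≤ M) (hεm0 : 0 ≤ εm) (hQdp : ∀ h, Qdp h = S ((LinearMap.adjoint Q) (SGinv h)))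
    (hQm : ∀ f, Qm f = (LinearMap.adjoint SGinv) (Q ((LinearMap.adjoint S) f))) (hM : ∀ y, ‖Q y‖ ≤ M * ‖y‖)
    (hEm : ∀ y, ‖Qm y - Q y‖ ≤ εm * ‖y‖) (h : G) : ‖Qdp h‖ ≤ (M + εm) * ‖h‖ :=
  norm_le_of_inner_eq_inner (add_nonneg hM0 hεm0) (inner_Qdp_eq hQdp hQm) (norm_Qm_le hM hEm) h

/-- **THE FORM DIFFERENCE BOUNDED BY THE LETTERS**: bond letters `‖B±y‖ ≤ β±‖y‖`, block letters `‖E±y‖ ≤ ε±‖y‖`, `‖Q̃′y‖ ≤ M‖y‖` ⇒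
`re⟪y, (H − H₊)y⟫ ≤ (β₊ + β₋)‖Dy‖‖y‖ + (β₊β₋ + a′((ε₊ + ε₋)M + ε₊ε₋))‖y‖²`. [folklore] [cite: Balaban1985BackgroundPropagators, (3.24) p.394, (3.49) p.399] -/
theorem re_inner_H_sub_Hp_le (hH : ∀ f, H f = (LinearMap.adjoint D) (D f) + ((a' : ℝ) : 𝕜) • (LinearMap.adjoint Q) (Q f))
    (hHp : ∀ f, Hp f = S (H (Sinv f))) (hSB : ∀ u, SBinv (SB u) = u) (hSG : ∀ v, SGinv (SG v) = v)
    (hDp : ∀ f, Dp f = SB (D (Sinv f))) (hDm : ∀ f, Dm f = (LinearMap.adjoint SBinv) (D ((LinearMap.adjoint S) f)))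
    (hQp : ∀ f, Qp f = SG (Q (Sinv f))) (hQm : ∀ f, Qm f = (LinearMap.adjoint SGinv) (Q ((LinearMap.adjoint S) f))) (ha : 0 ≤ a')
    {βp βm εp εm M : ℝ} (hβm0 : 0 ≤ βm) (hεp0 : 0 ≤ εp) (hεm0 : 0 ≤ εm)
    (hBp : ∀ y, ‖Dp y - D y‖ ≤ βp * ‖y‖) (hBm : ∀ y, ‖Dm y - D y‖ ≤ βm * ‖y‖)
    (hEp : ∀ y, ‖Qp y - Q y‖ ≤ εp * ‖y‖) (hEm : ∀ y, ‖Qm y - Q y‖ ≤ εm * ‖y‖) (hM : ∀ y, ‖Q y‖ ≤ M * ‖y‖) (y : E) :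
    RCLike.re ⟪y, H y - Hp y⟫_𝕜 ≤ (βp + βm) * ‖D y‖ * ‖y‖ + (βp * βm + a' * ((εp + εm) * M + εp * εm)) * ‖y‖ ^ 2 := by
  have e : ⟪y, H y - Hp y⟫_𝕜 = -((⟪Dm y, Dp y⟫_𝕜 - ⟪D y, D y⟫_𝕜) + ((a' : ℝ) : 𝕜) * (⟪Qm y, Qp y⟫_𝕜 - ⟪Q y, Q y⟫_𝕜)) := by
    rw [inner_sub_right, inner_H hH, inner_Hp hH hHp hSB hSG hDp hDm hQp hQm]; ring
  have h1 := norm_gram_pert_le (𝕜 := 𝕜) hβm0 hBp hBm y y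
  have h2 := norm_gram_pert_le (𝕜 := 𝕜) hεm0 hEp hEm y y
  have h3 : RCLike.re ⟪y, H y - Hp y⟫_𝕜 ≤ ‖⟪Dm y, Dp y⟫_𝕜 - ⟪D y, D y⟫_𝕜‖ + a' * ‖⟪Qm y, Qp y⟫_𝕜 - ⟪Q y, Q y⟫_𝕜‖ := by
    rw [e, map_neg, map_add, RCLike.re_ofReal_mul]
    have ha1 := RCLike.abs_re_le_norm (⟪Dm y, Dp y⟫_𝕜 - ⟪D y, D y⟫_𝕜)
    have ha2 := RCLike.abs_re_le_norm (⟪Qm y, Qp y⟫_𝕜 - ⟪Q y, Q y⟫_𝕜)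
    rw [abs_le] at ha1 ha2
    nlinarith [ha1.1, ha2.1]
  have hQ := hM y
  have h4 : εp * ‖Q y‖ * ‖y‖ ≤ εp * (M * ‖y‖) * ‖y‖ := mul_le_mul_of_nonneg_right (mul_le_mul_of_nonneg_left hQ hεp0) (norm_nonneg _)
  have h5 : εm * ‖y‖ * ‖Q y‖ ≤ εm * ‖y‖ * (M * ‖y‖) := mul_le_mul_of_nonneg_left hQ (mul_nonneg hεm0 (norm_nonneg _))
  have h6 : a' * ‖⟪Qm y, Qp y⟫_𝕜 - ⟪Q y, Q y⟫_𝕜‖ ≤ a' * (((εp + εm) * M + εp * εm) * ‖y‖ ^ 2) := by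
    apply mul_le_mul_of_nonneg_left _ ha
    nlinarith [h2, h4, h5]
  nlinarith [h1, h3, h6]

/-- The other sign: `re⟪y, (H₊ − H)y⟫` obeys the same bound. [folklore] [cite: Balaban1985BackgroundPropagators, (3.24) p.394, (3.49) p.399] -/
theorem re_inner_Hp_sub_H_le (hH : ∀ f, H f = (LinearMap.adjoint D) (D f) + ((a' : ℝ) : 𝕜) • (LinearMap.adjoint Q) (Q f))
    (hHp : ∀ f, Hp f = S (H (Sinv f))) (hSB : ∀ u, SBinv (SB u) = u) (hSG : ∀ v, SGinv (SG v) = v)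
    (hDp : ∀ f, Dp f = SB (D (Sinv f))) (hDm : ∀ f, Dm f = (LinearMap.adjoint SBinv) (D ((LinearMap.adjoint S) f)))
    (hQp : ∀ f, Qp f = SG (Q (Sinv f))) (hQm : ∀ f, Qm f = (LinearMap.adjoint SGinv) (Q ((LinearMap.adjoint S) f))) (ha : 0 ≤ a')
    {βp βm εp εm M : ℝ} (hβm0 : 0 ≤ βm) (hεp0 : 0 ≤ εp) (hεm0 : 0 ≤ εm)
    (hBp : ∀ y, ‖Dp y - D y‖ ≤ βp * ‖y‖) (hBm : ∀ y, ‖Dm y - D y‖ ≤ βm * ‖y‖)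
    (hEp : ∀ y, ‖Qp y - Q y‖ ≤ εp * ‖y‖) (hEm : ∀ y, ‖Qm y - Q y‖ ≤ εm * ‖y‖) (hM : ∀ y, ‖Q y‖ ≤ M * ‖y‖) (y : E) :
    RCLike.re ⟪y, Hp y - H y⟫_𝕜 ≤ (βp + βm) * ‖D y‖ * ‖y‖ + (βp * βm + a' * ((εp + εm) * M + εp * εm)) * ‖y‖ ^ 2 := by
  have e : ⟪y, Hp y - H y⟫_𝕜 = (⟪Dm y, Dp y⟫_𝕜 - ⟪D y, D y⟫_𝕜) + ((a' : ℝ) : 𝕜) * (⟪Qm y, Qp y⟫_𝕜 - ⟪Q y, Q y⟫_𝕜) := by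
    rw [inner_sub_right, inner_H hH, inner_Hp hH hHp hSB hSG hDp hDm hQp hQm]; ring
  have h1 := norm_gram_pert_le (𝕜 := 𝕜) hβm0 hBp hBm y y
  have h2 := norm_gram_pert_le (𝕜 := 𝕜) hεm0 hEp hEm y y
  have h3 : RCLike.re ⟪y, Hp y - H y⟫_𝕜 ≤ ‖⟪Dm y, Dp y⟫_𝕜 - ⟪D y, D y⟫_𝕜‖ + a' * ‖⟪Qm y, Qp y⟫_𝕜 - ⟪Q y, Q y⟫_𝕜‖ := by
    rw [e, map_add, RCLike.re_ofReal_mul]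
    have ha1 := RCLike.abs_re_le_norm (⟪Dm y, Dp y⟫_𝕜 - ⟪D y, D y⟫_𝕜)
    have ha2 := RCLike.abs_re_le_norm (⟪Qm y, Qp y⟫_𝕜 - ⟪Q y, Q y⟫_𝕜)
    rw [abs_le] at ha1 ha2
    nlinarith [ha1.2, ha2.2]
  have hQ := hM y
  have h4 : εp * ‖Q y‖ * ‖y‖ ≤ εp * (M * ‖y‖) * ‖y‖ := mul_le_mul_of_nonneg_right (mul_le_mul_of_nonneg_left hQ hεp0) (norm_nonneg _)
  have h5 : εm * ‖y‖ * ‖Q y‖ ≤ εm * ‖y‖ * (M * ‖y‖) := mul_le_mul_of_nonneg_left hQ (mul_nonneg hεm0 (norm_nonneg _))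
  have h6 : a' * ‖⟪Qm y, Qp y⟫_𝕜 - ⟪Q y, Q y⟫_𝕜‖ ≤ a' * (((εp + εm) * M + εp * εm) * ‖y‖ ^ 2) := by
    apply mul_le_mul_of_nonneg_left _ ha
    nlinarith [h2, h4, h5]
  nlinarith [h1, h3, h6]

/-- **`hHH` DISCHARGED — LITERALLY the `hHH` binder of `B9Eq349ConjugatedProjection.norm_D_le_on_range` ∕ `norm_conjDP_le_two`**: with the symmetric
letters `β± ≤ β`, `ε± ≤ ε` (the conjugation letters see `|κ|` only) and `M`: `re⟪y, Hy − H₊y⟫ ≤ 2β‖Dy‖‖y‖ + (β² + a′(2Mε + ε²))‖y‖²`, i.e. `c = β² +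
a′(2Mε + ε²)`. [folklore] [cite: Balaban1985BackgroundPropagators, (3.24) p.394, (3.49) p.399] -/
theorem hHH_of_structure (hH : ∀ f, H f = (LinearMap.adjoint D) (D f) + ((a' : ℝ) : 𝕜) • (LinearMap.adjoint Q) (Q f))
    (hHp : ∀ f, Hp f = S (H (Sinv f))) (hSB : ∀ u, SBinv (SB u) = u) (hSG : ∀ v, SGinv (SG v) = v)
    (hDp : ∀ f, Dp f = SB (D (Sinv f))) (hDm : ∀ f, Dm f = (LinearMap.adjoint SBinv) (D ((LinearMap.adjoint S) f)))
    (hQp : ∀ f, Qp f = SG (Q (Sinv f))) (hQm : ∀ f, Qm f = (LinearMap.adjoint SGinv) (Q ((LinearMap.adjoint S) f))) (ha : 0 ≤ a')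
    {β ε M : ℝ} (hβ0 : 0 ≤ β) (hε0 : 0 ≤ ε) (hBp : ∀ y, ‖Dp y - D y‖ ≤ β * ‖y‖) (hBm : ∀ y, ‖Dm y - D y‖ ≤ β * ‖y‖)
    (hEp : ∀ y, ‖Qp y - Q y‖ ≤ ε * ‖y‖) (hEm : ∀ y, ‖Qm y - Q y‖ ≤ ε * ‖y‖) (hM : ∀ y, ‖Q y‖ ≤ M * ‖y‖) (y : E) :
    RCLike.re ⟪y, H y - Hp y⟫_𝕜 ≤ 2 * β * ‖D y‖ * ‖y‖ + (β ^ 2 + a' * (2 * M * ε + ε ^ 2)) * ‖y‖ ^ 2 := by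
  have h := re_inner_H_sub_Hp_le hH hHp hSB hSG hDp hDm hQp hQm ha hβ0 hε0 hε0 hBp hBm hEp hEm hM y
  have e1 : (β + β) * ‖D y‖ * ‖y‖ = 2 * β * ‖D y‖ * ‖y‖ := by ring
  have e2 : (β * β + a' * ((ε + ε) * M + ε * ε)) * ‖y‖ ^ 2 = (β ^ 2 + a' * (2 * M * ε + ε ^ 2)) * ‖y‖ ^ 2 := by ring
  linarith [h, e1, e2]

end Structure

/-! ## §3 Non-vacuity: the §1–§2 letter set is jointly inhabited (zero maps on `𝕜`, weights the identity, `a′ = 1`; a consistency check, not a lattice model) -/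

/-- `D = Q̃′ = H = H₊ = S = S⁻¹ = 0` on `𝕜`, `S_B = S_G = 1`, `a′ = 1`, all letters `0`. [folklore] [cite: Balaban1985BackgroundPropagators, (3.24) p.394] -/
example (y : 𝕜) : RCLike.re ⟪y, (0 : 𝕜 →ₗ[𝕜] 𝕜) y - (0 : 𝕜 →ₗ[𝕜] 𝕜) y⟫_𝕜 ≤
    2 * 0 * ‖(0 : 𝕜 →ₗ[𝕜] 𝕜) y‖ * ‖y‖ + (0 ^ 2 + (1 : ℝ) * (2 * 0 * 0 + 0 ^ 2)) * ‖y‖ ^ 2 :=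
  hHH_of_structure (E := 𝕜) (G := 𝕜) (B := 𝕜) (D := 0) (Dp := 0) (Dm := 0) (Q := 0) (Qp := 0) (Qm := 0) (H := 0) (Hp := 0) (S := 0) (Sinv := 0)
    (SB := LinearMap.id) (SBinv := LinearMap.id) (SG := LinearMap.id) (SGinv := LinearMap.id) (a' := 1)
    (fun f => by simp) (fun f => by simp) (fun u => by simp) (fun v => by simp) (fun f => by simp) (fun f => by simp) (fun f => by simp)
    (fun f => by simp) zero_le_one le_rfl le_rfl (fun y => by simp) (fun y => by simp) (fun y => by simp) (fun y => by simp) (fun y => by simp) y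

end Literature.MathematicalPhysics.QuantumFieldTheory.Balaban1983to89.B9Eq324ConjugatedFormDifference
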